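import Mathlib
import Summits.Ventures.PercRepro.TriangleCapEqualityLocus
import Summits.Ventures.PercRepro.TriangleCapMantelStability

/-!
# PercRepro — THE EQUALITY LOCUS ON THE TRIANGLE-FREE CLASS, EVERY CELL (p3, gen 41; part 170)

On the triangle-free class the equality locus of part 168 needs no `k ≥ r + 7`: for `3 ≤ a` and `2a + r ≤ k` a
triangle-free graph on `k` vertices with `a (k − a) − r` edges attains `Σ_v d(v)² = m k − r (k − 1 − r)` iff it is
`K_{a, k−a}` minus a star of `r` edges at one vertex (`closed_form_eq_iff_cliqueFree`,
`closed_form_equality_locus_cliqueFree`). A triangle-free graph is `K₄⁻`-free (`k4mFree_of_cliqueFree`: a `4`-set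
with a vertex of three inner neighbours has no other inner edge, otherwise every inner degree is `≤ 2`), so the
degree argument at equality (part 167) applies verbatim; what changes is the base (Mantel's degree-sum lemma is
stable on every `k`, part 133, so the diagonal's locus is complete bipartite spanning with no `k ≥ 7`) and the
transport when `k − 1 = 2a` (two neighbours of `z` on different sides of the complete bipartite `D − z` would be
adjacent, a triangle). The `K₄⁻`-free exceptions at `k − r = 6` (part 168) therefore all contain a triangle.
Axioms: standard.
-/

namespace PercRepro

namespace TriangleCap

namespace C047

open Finset

universe u

variable {V : Type*} [Fintype V] [DecidableEq V]

omit [Fintype V] in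
/-- **A triangle-free graph is `K₄⁻`-free:** every `4`-set carries at most `8` ordered adjacent pairs. -/
theorem k4mFree_of_cliqueFree (D : SimpleGraph V) [DecidableRel D.Adj] (hfree : D.CliqueFree 3) : K4mFree D := by
  intro S hS
  unfold adjPairs
  have hsum : ((S ×ˢ S).filter (fun p => D.Adj p.1 p.2)).card =
      ∑ x ∈ S, (S.filter (fun y => D.Adj x y)).card := by
    rw [card_filter, sum_product]
    apply sum_congr rfl
    intro x _
    rw [card_filter]
  rw [hsum]
  have hnb : ∀ x ∈ S, S.filter (fun y => D.Adj x y) ⊆ S.erase x := by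
    intro x _ y hy
    rw [mem_filter] at hy
    rw [mem_erase]
    exact ⟨hy.2.ne.symm, hy.1⟩
  by_cases h3 : ∃ x ∈ S, 3 ≤ (S.filter (fun y => D.Adj x y)).card
  · obtain ⟨x, hx, hx3⟩ := h3
    have hfull : S.filter (fun y => D.Adj x y) = S.erase x :=
      eq_of_subset_of_card_le (hnb x hx) (by rw [card_erase_of_mem hx, hS]; omega)
    have hone : ∀ y ∈ S, y ≠ x → (S.filter (fun w => D.Adj y w)).card ≤ 1 := by
      intro y hy hyx
      have hxy : D.Adj x y := by
        have : y ∈ S.filter (fun y => D.Adj x y) := by rw [hfull, mem_erase]; exact ⟨hyx, hy⟩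
        exact (mem_filter.mp this).2
      have key : ∀ w, w ∈ S → D.Adj y w → w = x := by
        intro w hw hyw
        by_contra hwx
        have : w ∈ S.filter (fun y => D.Adj x y) := by rw [hfull, mem_erase]; exact ⟨hwx, hw⟩
        have hxw := (mem_filter.mp this).2
        exact hfree {x, y, w} (SimpleGraph.is3Clique_triple_iff.mpr ⟨hxy, hxw, hyw⟩)
      rw [card_le_one]
      intro w hw w' hw'
      rw [mem_filter] at hw hw'
      rw [key w hw.1 hw.2, key w' hw'.1 hw'.2]
    rw [← add_sum_erase S _ hx]
    have h1 : (S.filter (fun y => D.Adj x y)).card ≤ 3 := by rw [hfull, card_erase_of_mem hx, hS]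
    have h2 : ∑ y ∈ S.erase x, (S.filter (fun w => D.Adj y w)).card ≤ ∑ _y ∈ S.erase x, 1 := by
      apply sum_le_sum
      intro y hy
      rw [mem_erase] at hy
      exact hone y hy.2 hy.1
    rw [sum_const, smul_eq_mul, card_erase_of_mem hx, hS] at h2
    omega
  · push Not at h3
    have h2 : ∑ x ∈ S, (S.filter (fun y => D.Adj x y)).card ≤ ∑ _x ∈ S, 2 := by
      apply sum_le_sum
      intro x hx
      have := h3 x hx
      omega
    rw [sum_const, smul_eq_mul, hS] at h2
    omega

omit [Fintype V] [DecidableEq V] in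
/-- Vertex deletion preserves triangle-freeness. -/
theorem cliqueFree_del (D : SimpleGraph V) (hfree : D.CliqueFree 3) (z : V) : (del D z).CliqueFree 3 :=
  hfree.comap (SimpleGraph.isContained_iff_exists_le_comap.mpr ⟨Function.Embedding.subtype _, le_of_eq rfl⟩)

/-- **THE TRANSPORT, TRIANGLE-FREE:** `D − z ≤ K(A', A'ᶜ)` with `|A'| = a`, every neighbour of `z` at the cap,
and `k − 1 − a > a` or (`k − 1 = 2a` and `D − z` complete bipartite spanning on `A'`) ⇒ `D ≤ K(A, Aᶜ)` for some
`A` with `|A| = a`. -/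
theorem bipSub_of_del_cliqueFree (D : SimpleGraph V) [DecidableRel D.Adj] (hfree : D.CliqueFree 3) (z : V)
    (a : ℕ) (A' : Finset {v : V // v ≠ z}) (hA' : A'.card = a) (hsub : BipSub (del D z) A')
    (hnb : ∀ x : {v : V // v ≠ z}, D.Adj x.1 z → deg D x.1 + a = Fintype.card V)
    (hside : a + a + 1 < Fintype.card V ∨
      (Fintype.card V = a + a + 1 ∧ ∀ x y, (del D z).Adj x y ↔ Xor (x ∈ A') (y ∈ A'))) :
    ∃ A : Finset V, A.card = a ∧ BipSub D A := by
  have hcard := card_del z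
  have hdel : ∀ x : {v : V // v ≠ z}, D.Adj x.1 z → deg (del D z) x + 1 + a = Fintype.card V := by
    intro x hx
    have h1 := deg_del D z x
    simp only [hx, if_true] at h1
    have := hnb x hx
    omega
  have hAc : A'ᶜ.card + a = Fintype.card V - 1 := by
    rw [card_compl, hA']
    have := card_le_univ A'
    omega
  rcases hside with hbig | ⟨hk, hxor⟩
  · have hin : ∀ x : {v : V // v ≠ z}, D.Adj x.1 z → x ∈ A' := by
      intro x hx
      by_contra hxA
      have h1 := deg_le_card_of_bipSub (del D z) A' hsub x hxA
      have h2 := hdel x hx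
      omega
    obtain ⟨B, hB, hBsub⟩ := bipSub_lift D z A' hsub hin
    exact ⟨B, by rw [hB, hA'], hBsub⟩
  · by_cases hin : ∀ x : {v : V // v ≠ z}, D.Adj x.1 z → x ∈ A'
    · obtain ⟨B, hB, hBsub⟩ := bipSub_lift D z A' hsub hin
      exact ⟨B, by rw [hB, hA'], hBsub⟩
    push Not at hin
    obtain ⟨y, hy, hyA⟩ := hin
    have hout : ∀ x : {v : V // v ≠ z}, D.Adj x.1 z → x ∈ A'ᶜ := by
      intro x hx
      rw [mem_compl]
      intro hxA
      have hxy : (del D z).Adj x y := by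
        rw [hxor]
        exact Or.inl ⟨hxA, hyA⟩
      exact hfree {z, x.1, y.1} (SimpleGraph.is3Clique_triple_iff.mpr ⟨hx.symm, hy.symm, hxy⟩)
    obtain ⟨B, hB, hBsub⟩ := bipSub_lift D z A'ᶜ (bipSub_compl (del D z) A' hsub) hout
    exact ⟨B, by rw [hB]; omega, hBsub⟩

/-- The diagonal's locus on the triangle-free class, every `k ≥ 3`: `Σ_v d(v)² = m k` ⇒ complete bipartite
spanning. -/
theorem complete_bipartite_of_mantel_eq (D : SimpleGraph V) [DecidableRel D.Adj] (hfree : D.CliqueFree 3)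
    (hk : 3 ≤ Fintype.card V)
    (heq : ∑ v, deg D v * deg D v = D.edgeFinset.card * Fintype.card V) :
    ∃ A : Finset V, ∀ x y, D.Adj x y ↔ Xor (x ∈ A) (y ∈ A) := by
  by_contra hnot
  have := mantel_stability D hfree hnot
  omega

/-- **THE EQUALITY LOCUS ON THE TRIANGLE-FREE CLASS BY STRONG INDUCTION ON `r`, EVERY VERTEX TYPE:** on `n`
vertices, triangle-free, `3 ≤ a`, `2a + r ≤ n`, `m + a² + r = a n`, `Σ_v d(v)² + r (n − 1 − r) = m n` ⇒ `D` is a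
spanning subgraph of `K(A, Aᶜ)` for some `A` with `|A| = a`. -/
theorem equality_locus_cliqueFree_aux (r : ℕ) :
    ∀ (W : Type u) [Fintype W] [DecidableEq W] (D : SimpleGraph W) [DecidableRel D.Adj], D.CliqueFree 3 →
      ∀ a, 3 ≤ a → 2 * a + r ≤ Fintype.card W →
      D.edgeFinset.card + a * a + r = a * Fintype.card W →
      ∑ v, deg D v * deg D v + r * (Fintype.card W - 1 - r) = D.edgeFinset.card * Fintype.card W →
      ∃ A : Finset W, A.card = a ∧ BipSub D A := by
  refine Nat.strong_induction_on r ?_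
  intro r ih W _ _ D _ hfree a ha hk hm heq
  have hK := k4mFree_of_cliqueFree D hfree
  rcases Nat.eq_zero_or_pos r with hr0 | hr1
  · subst hr0
    simp only [zero_mul, add_zero] at heq
    obtain ⟨A, hA⟩ := complete_bipartite_of_mantel_eq D hfree (by omega) heq
    have hsub : BipSub D A := bipSub_of_xor D A hA
    have hcardE := card_edges_eq_of_complete_bipartite D A hA
    have hcell : D.edgeFinset.card = a * (Fintype.card W - a) := by
      have := cell_edges a 0 (Fintype.card W) D.edgeFinset.card (by simpa using hm) (by omega)
      simpa using this
    rcases eq_or_eq_of_mul_sub_eq A.card a (Fintype.card W) (card_le_univ A) (by omega) (by omega) with h | h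
    · exact ⟨A, h, hsub⟩
    · exact ⟨Aᶜ, by rw [card_compl]; omega, bipSub_compl D A hsub⟩
  have hcap : ∀ v, deg D v + a ≤ Fintype.card W := fun v =>
    deg_add_le_card_of_dense D hK a ha (by omega)
      (cap_arith a (Fintype.card W) D.edgeFinset.card r (by omega) hk hm) v
  by_cases hdeg : ∀ z, a ≤ deg D z
  · exfalso
    have h1 := band_stability_of_min_degree_strict D a r hcap hdeg (by omega) hm
    have h2 : r * (Fintype.card W - 1 - r) < r * Fintype.card W :=
      Nat.mul_lt_mul_of_pos_left (by omega) hr1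
    omega
  push Not at hdeg
  obtain ⟨z, hz⟩ := hdeg
  rcases Nat.lt_or_ge (r + deg D z) a with hcross | hwithin
  · exfalso
    have := band_of_low_degree_cross_strict D hK a r hcap (z := z) (by omega) (by omega) (by omega) hm
    omega
  · have hK' := k4mFree_del D hK z
    have hfree' := cliqueFree_del D hfree z
    have hcard' := card_del z
    have hedges' := card_edges_del D z
    have hak : a * Fintype.card W = a * Fintype.card {v : W // v ≠ z} + a := by
      rw [← hcard']
      ring
    have hm' : (del D z).edgeFinset.card + a * a + (r + deg D z - a) = a * Fintype.card {v : W // v ≠ z} := by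
      omega
    have hrow := closed_form_stability (del D z) hK' a (r + deg D z - a) ha (by omega) hm'
    obtain ⟨hcase, hnb, heq'⟩ :=
      band_of_low_degree_eq D a r hcap (z := z) (by omega) hwithin (by omega) hm hrow heq
    rcases Nat.lt_or_ge (a + a + 1) (Fintype.card W) with hbig | hsmall
    · obtain ⟨A', hA', hsub'⟩ := ih (r + deg D z - a) (by omega) {v : W // v ≠ z} (del D z) hfree' a ha
        (by omega) hm' heq'
      exact bipSub_of_del_cliqueFree D hfree z a A' hA' hsub' hnb (Or.inl hbig)
    · -- `k = 2a + 1`: `r = 1`, `D − z` on the diagonal at `2a`, complete bipartite by Mantel's stability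
      have hkW : Fintype.card W = a + a + 1 := by omega
      have hr' : r + deg D z - a = 0 := by omega
      rw [hr'] at heq' hm'
      simp only [zero_mul, add_zero] at heq' hm'
      obtain ⟨A', hA'⟩ := complete_bipartite_of_mantel_eq (del D z) hfree' (by omega) heq'
      have hsub' : BipSub (del D z) A' := bipSub_of_xor (del D z) A' hA'
      have hcardE := card_edges_eq_of_complete_bipartite (del D z) A' hA'
      have hcell : (del D z).edgeFinset.card = a * (Fintype.card {v : W // v ≠ z} - a) := by
        have := cell_edges a 0 (Fintype.card {v : W // v ≠ z}) (del D z).edgeFinset.card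
          (by simpa using hm') (by omega)
        simpa using this
      have hA'a : A'.card = a := by
        rcases eq_or_eq_of_mul_sub_eq A'.card a (Fintype.card {v : W // v ≠ z}) (card_le_univ A') (by omega)
          (by omega) with h | h
        · exact h
        · omega
      exact bipSub_of_del_cliqueFree D hfree z a A' hA'a hsub' hnb (Or.inr ⟨hkW, hA'⟩)

/-- **THE EQUALITY LOCUS ON THE TRIANGLE-FREE CLASS (degree form, every vertex type, every cell):** triangle-free,
`3 ≤ a`, `2a + r ≤ k`, `m + a² + r = a k`: `Σ_v d(v)² + r (k − 1 − r) = m k` iff `D` is a spanning subgraph of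
some `K(A, Aᶜ)` with `|A| = a` whose missing cross pairs form a star. -/
theorem closed_form_eq_iff_cliqueFree (D : SimpleGraph V) [DecidableRel D.Adj] (hfree : D.CliqueFree 3)
    (a r : ℕ) (ha : 3 ≤ a) (hk : 2 * a + r ≤ Fintype.card V)
    (hm : D.edgeFinset.card + a * a + r = a * Fintype.card V) :
    ∑ v, deg D v * deg D v + r * (Fintype.card V - 1 - r) = D.edgeFinset.card * Fintype.card V ↔
      ∃ (A : Finset V) (v : V), A.card = a ∧ BipSub D A ∧ MissingStar D A v := by
  have hcell := cell_edges a r (Fintype.card V) D.edgeFinset.card hm (by omega)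
  constructor
  · intro heq
    obtain ⟨A, hA, hsub⟩ := equality_locus_cliqueFree_aux r V D hfree a ha hk hm heq
    obtain ⟨v, hv⟩ := exists_missingStar_of_closed_form_eq D A hsub a r hA hcell (by omega) heq
    exact ⟨A, v, hA, hsub, hv⟩
  · rintro ⟨A, v, hA, hsub, hv⟩
    exact closed_form_eq_of_missingStar D A hsub hv a r hA hcell (by omega)

/-- **THE EQUALITY LOCUS ON THE TRIANGLE-FREE CLASS ON `Fin k` (cherry form, every cell):** for `3 ≤ a` and
`2a + r ≤ k`, a triangle-free graph on `Fin k` with `a (k − a) − r` edges attains `2·Σ_v C(d(v), 2) =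
(a (k − a) − r)(k − 2) − r (k − 1 − r)` iff it is `K_{a, k−a}` minus a star of `r` edges at one vertex. -/
theorem closed_form_equality_locus_cliqueFree (k a r : ℕ) (ha : 3 ≤ a) (hk : 2 * a + r ≤ k)
    (D : SimpleGraph (Fin k)) [DecidableRel D.Adj] (hfree : D.CliqueFree 3)
    (hD : D.edgeFinset.card = a * (k - a) - r) :
    2 * cherries D + r * (k - 1 - r) = (a * (k - a) - r) * (k - 2) ↔
      ∃ (A : Finset (Fin k)) (v : Fin k), A.card = a ∧ BipSub D A ∧ MissingStar D A v := by
  have hcard : Fintype.card (Fin k) = k := Fintype.card_fin k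
  have hrle : r ≤ a * (k - a) := by
    obtain ⟨c, hc⟩ : ∃ c, k = a + c := ⟨k - a, by omega⟩
    rw [hc, Nat.add_sub_cancel_left]
    have : c ≤ a * c := Nat.le_mul_of_pos_left c (by omega)
    omega
  have hm : D.edgeFinset.card + a * a + r = a * Fintype.card (Fin k) := by
    rw [hcard, hD]
    obtain ⟨c, hc⟩ : ∃ c, k = a + c := ⟨k - a, by omega⟩
    rw [hc, Nat.add_sub_cancel_left] at hrle ⊢
    obtain ⟨q, hq⟩ : ∃ q, a * c = r + q := ⟨a * c - r, by omega⟩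
    rw [hq, Nat.add_sub_cancel_left]
    nlinarith [hq]
  rw [← closed_form_eq_iff_cliqueFree D hfree a r ha (by rw [hcard]; exact hk) hm, hcard, ← hD]
  have h2 := two_mul_cherries_add D
  have h3 := sum_deg_eq D
  have e : D.edgeFinset.card * (k - 2) + 2 * D.edgeFinset.card = D.edgeFinset.card * k := by
    rw [mul_comm 2, ← Nat.mul_add, Nat.sub_add_cancel (by omega : 2 ≤ k)]
  omega

end C047

end TriangleCap

end PercRepro
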